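import Literature.MathematicalPhysics.QuantumManyBody.PeriodicBoseGas
import Mathlib.Analysis.Calculus.FDeriv.Add
import Mathlib.MeasureTheory.Function.LocallyIntegrable
import Mathlib.Algebra.QuadraticDiscriminant
import HarnessLib

/-!
# Weighted Dirichlet form, `H₋₁` norm and weak correctors on the `N`-particle torus

Topic `Literature/MathematicalPhysics/QuantumManyBody` (definition item `defn-WeightedCorrector`;
wanted by the Bose-gas routes that linearise the ground-state equation around a *positive*
periodic trial function — policy iteration / Newton on `log Ψ₀`, Kipnis–Varadhan correctors of an
insertion — and phrased over the periodic box of `PeriodicBoseGas.lean`).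

**Setting.** `N` particles on the torus `(ℝ³/Lℤ³)^N` with fundamental cell
`cellN N L = [0,L)^{3N}` and a weight `F : Config N → ℝ` (in the applications `F = e^{-S} > 0`,
`C¹` and periodic: a Jastrow or iterated trial function), giving the (unnormalised) symmetrising
measure `μ_F = F² dX` on the cell. The `μ_F`-symmetric diffusion ("Langevin dynamics of the trial
function `F`") has Dirichlet form `𝓔_F(φ, ψ) = ∫ ∇φ·∇ψ F² dX` and generator
`L_F = Δ + 2∇(log F)·∇` (drift `2∇log F`; `⟨φ, -L_F ψ⟩_{μ_F} = 𝓔_F(φ, ψ)` by one integration by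
parts on the torus), which is the ground-state (Doob `h`-) transform of the Schrödinger-type
operator `-Δ + (ΔF)/F`: `F⁻¹ (-Δ + (ΔF)/F) (F φ) = -L_F φ`.

* `pderiv i k φ X = ∂φ/∂x_{i,k}(X)` and the carré du champ
  `gradDot φ ψ X = ∇φ(X)·∇ψ(X) = ∑ᵢ ∑ₖ ∂_{i,k}φ ∂_{i,k}ψ`.
* `IsPeriodicTest L φ` — the core of test functions: `φ : (ℝ³)^N → ℝ` of class `C¹` and
  `Lℤ³`-periodic in every particle (periodicity on the generators `L e_{i,k}`, as in
  `PeriodicTrialState`).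
* `dirichletFormW L F φ ψ = 𝓔_F(φ, ψ) = ∫_{[0,L)^{3N}} ∇φ·∇ψ F² dX` (real, bilinear).
* `hMinusOneSqW L F g = ‖g‖²_{-1} = sup_φ {2 ∫ g φ F² dX - 𝓔_F(φ, φ)} ∈ [0, ∞]`, the supremum over
  periodic test functions `φ` — the (Kipnis–Varadhan) `H₋₁` norm, squared, of a real observable
  `g` with respect to `(𝓔_F, μ_F)`, by the variational formula
  [KipnisLandim1999, App. 1 §6 (6.1)]: `‖f‖²₋₁ = sup_g {2⟨f, g⟩_π - ‖g‖₁²}`, `‖g‖₁² = ⟨g, (-S)g⟩_π`.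
  It is finite iff `(∫ g φ F²)² ≤ C 𝓔_F(φ, φ)` for all test `φ` — Kipnis–Varadhan's standing
  hypothesis [KipnisVaradhan1986, (1.14)]: `|⟨V, φ⟩| ≤ C ⟨-Lφ, φ⟩^{1/2}` — and then equals the best
  such constant (`hMinusOneSqW_le_ofReal_iff`); formally `‖g‖²₋₁ = ⟨g, (-L_F)⁻¹ g⟩_{μ_F} =
  ∫₀^∞ ⟨g, e^{t L_F} g⟩ dt`, one half of the Kipnis–Varadhan limiting variance
  `σ² = 2∫₀^∞ ⟨T_t V, V⟩ dt = 2⟨-L⁻¹V, V⟩` [KipnisVaradhan1986, Cor. 1.9]. It is `+∞` unless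
  `∫ g F² = 0` (`hMinusOneSqW_eq_top`: test against constants) and scales quadratically
  (`hMinusOneSqW_smul`).
* `IsWeakCorrector L F g δ` — `δ` is a periodic test function solving the weighted Poisson
  ("corrector") equation `-L_F δ = g` weakly: `𝓔_F(δ, φ) = ∫ g φ F² dX` for every periodic test
  `φ`. Then `‖g‖²₋₁ = 𝓔_F(δ, δ) = ∫ g δ F² dX` (`IsWeakCorrector.hMinusOneSqW_eq`), the identity
  `‖S f‖₋₁ = ‖f‖₁` of [KipnisLandim1999, App. 1 §6 (after (6.2))].

API: symmetry and scaling of `gradDot`/`dirichletFormW`, closure properties of `IsPeriodicTest`,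
continuity and integrability on the cell (`integrableOn_cellN`), `dirichletFormW_self_nonneg`,
the polarisation `dirichletFormW_sub_sub`, the variational bound `le_hMinusOneSqW`, the criterion
`hMinusOneSqW_le_ofReal_iff`, `hMinusOneSqW_zero`, `hMinusOneSqW_smul`, `hMinusOneSqW_eq_top`,
and the corrector identity.

## Design choices

* Real Bochner integrals on the cell (the forms are bilinear and sign-indefinite off the
  diagonal); `ℝ≥0∞` for the `H₋₁` norm, a supremum that is `+∞` off `H₋₁`. No junk values: the
  `φ = 0` term is `0`, so truncating each term at `0` by `ENNReal.ofReal` does not change the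
  supremum, and `hMinusOneSqW ≤ ENNReal.ofReal C` with `0 ≤ C` is literally the real statement.
* The supremum runs over the *core* of `C¹` periodic functions (Kipnis–Landim take all of
  `L²(π)`, their generator being bounded): for `g ∈ L²(F² dX)` the functional
  `φ ↦ 2⟨g, φ⟩ - 𝓔_F(φ, φ)` is continuous for the form norm, so the supremum over a core equals
  the supremum over the domain of the closure of `(𝓔_F, C¹_per)`; the definition thereby fixes
  the Dirichlet form as that closure (for `F` continuous and `> 0` the weighted Sobolev space
  `H¹(F² dX)` of the torus). Likewise the corrector equation is the weak (distributional on the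
  torus) form of `-L_F δ = g`, tested on the same core; no operator, semigroup or resolvent is
  constructed.
* `μ_F` is not normalised (the requester's convention: all three objects are homogeneous of
  degree two in `F`); `F` is unbundled and hypotheses (`Continuous F`) appear only where used;
  `N` is implicit (read off `F`), `L` explicit.
* Deliberately not here: existence/uniqueness of correctors (needs the closed form and a
  Poincaré inequality or `H₋₁` data), the free case `F ≡ 1` (`Ḣ⁻¹` of the torus by Fourier
  series), Markov uniqueness of the core, and the Kipnis–Varadhan invariance principle itself.
* Mathlib has abstract bilinear forms but no Dirichlet forms, carré du champ or `H₋₁` spaces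
  (searched `DirichletForm`, `carreDuChamp`, `HMinusOne`); `fderiv`, `ContDiff`, the Bochner
  integral and `discrim` are Mathlib's. The tree's `Literature.Analysis.FluidPDE.pderiv` is the
  coordinate derivative on a single `EuclideanSpace ℝ ι`; `pderiv i k` here is its analogue on the
  product `Config N = Fin N → ℝ³` (sup-normed `Pi` type, not a `EuclideanSpace`), with the unit
  vectors `Pi.single i (EuclideanSpace.single k 1)` of `kineticDensity`.

## References

* [KipnisLandim1999] C. Kipnis, C. Landim, *Scaling Limits of Interacting Particle Systems*,
  Grundlehren 320, Springer 1999: Appendix 1, §6 "Estimates on the variance of additive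
  functionals", (6.1) (the `H₋₁` norm as a supremum), (6.2), and `‖Sf‖²₋₁ = ‖f‖₁²`.
* [KipnisVaradhan1986] C. Kipnis, S. R. S. Varadhan, *Central limit theorem for additive
  functionals of reversible Markov processes and applications to simple exclusions*, Comm. Math.
  Phys. 104 (1986) 1–19: §1, condition (1.14), Theorem 1.8, Corollary 1.9.
-/

noncomputable section

open MeasureTheory Metric
open scoped ENNReal NNReal

namespace Literature.MathematicalPhysics.QuantumManyBody.BoseGas

variable {N : ℕ}

/-! ### Partial derivatives and the carré du champ on `(ℝ³)^N` -/

section Gradient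

variable {φ ψ φ₁ φ₂ : Config N → ℝ} {X : Config N}

/-- The partial derivative `∂φ/∂x_{i,k}(X)` of a real function on `(ℝ³)^N` along coordinate `k`
of particle `i`: the Fréchet derivative at `X` applied to the unit vector `e_{i,k}` (Mathlib's
convention `fderiv = 0` where `φ` is not differentiable). [folklore] -/
def pderiv (i : Fin N) (k : Fin 3) (φ : Config N → ℝ) (X : Config N) : ℝ :=
  fderiv ℝ φ X (Pi.single i (EuclideanSpace.single k 1))

/-- The **carré du champ** `Γ(φ, ψ)(X) = ∇φ(X)·∇ψ(X) = ∑ᵢ ∑ₖ ∂_{i,k}φ(X) ∂_{i,k}ψ(X)` of the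
Laplacian on `(ℝ³)^N` (Euclidean inner product of the gradients). [folklore] -/
def gradDot (φ ψ : Config N → ℝ) (X : Config N) : ℝ :=
  ∑ i : Fin N, ∑ k : Fin 3, pderiv i k φ X * pderiv i k ψ X

/-- `∂_{i,k}(c φ) = c ∂_{i,k}φ` (no differentiability needed over a field). [folklore] -/
@[simp]
theorem pderiv_const_smul (c : ℝ) (φ : Config N → ℝ) (X : Config N) (i : Fin N) (k : Fin 3) :
    pderiv i k (c • φ) X = c * pderiv i k φ X := by
  simp [pderiv, fderiv_const_smul_field]

/-- `∂_{i,k}` of a constant vanishes. [folklore] -/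
@[simp]
theorem pderiv_const (c : ℝ) (X : Config N) (i : Fin N) (k : Fin 3) :
    pderiv i k (fun _ : Config N => c) X = 0 := by
  simp [pderiv]

/-- `∂_{i,k}(φ + ψ) = ∂_{i,k}φ + ∂_{i,k}ψ` at points of differentiability. [folklore] -/
theorem pderiv_add (hφ : DifferentiableAt ℝ φ X) (hψ : DifferentiableAt ℝ ψ X) (i : Fin N)
    (k : Fin 3) : pderiv i k (φ + ψ) X = pderiv i k φ X + pderiv i k ψ X := by
  simp [pderiv, fderiv_add hφ hψ]

/-- `∂_{i,k}(φ - ψ) = ∂_{i,k}φ - ∂_{i,k}ψ` at points of differentiability. [folklore] -/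
theorem pderiv_sub (hφ : DifferentiableAt ℝ φ X) (hψ : DifferentiableAt ℝ ψ X) (i : Fin N)
    (k : Fin 3) : pderiv i k (φ - ψ) X = pderiv i k φ X - pderiv i k ψ X := by
  simp [pderiv, fderiv_sub hφ hψ]

/-- `∂_{i,k}φ` is continuous for `φ ∈ C¹`. [folklore] -/
theorem continuous_pderiv (hφ : ContDiff ℝ 1 φ) (i : Fin N) (k : Fin 3) :
    Continuous (pderiv i k φ) :=
  (hφ.continuous_fderiv one_ne_zero).clm_apply continuous_const

/-- `Γ` is symmetric. [folklore] -/
theorem gradDot_comm (φ ψ : Config N → ℝ) (X : Config N) : gradDot φ ψ X = gradDot ψ φ X := by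
  simp only [gradDot, mul_comm]

/-- `Γ(c φ, ψ) = c Γ(φ, ψ)`. [folklore] -/
theorem gradDot_smul_left (c : ℝ) (φ ψ : Config N → ℝ) (X : Config N) :
    gradDot (c • φ) ψ X = c * gradDot φ ψ X := by
  simp only [gradDot, pderiv_const_smul, Finset.mul_sum, mul_assoc]

/-- `Γ(φ, c ψ) = c Γ(φ, ψ)`. [folklore] -/
theorem gradDot_smul_right (c : ℝ) (φ ψ : Config N → ℝ) (X : Config N) :
    gradDot φ (c • ψ) X = c * gradDot φ ψ X := by
  rw [gradDot_comm, gradDot_smul_left, gradDot_comm]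

/-- `Γ(φ, φ) = |∇φ|² ≥ 0`. [folklore] -/
theorem gradDot_self_nonneg (φ : Config N → ℝ) (X : Config N) : 0 ≤ gradDot φ φ X :=
  Finset.sum_nonneg fun _ _ => Finset.sum_nonneg fun _ _ => mul_self_nonneg _

/-- `Γ(φ, c) = 0` for a constant `c`. [folklore] -/
@[simp]
theorem gradDot_const_right (φ : Config N → ℝ) (c : ℝ) (X : Config N) :
    gradDot φ (fun _ : Config N => c) X = 0 := by
  simp [gradDot]

/-- `Γ(c, ψ) = 0` for a constant `c`. [folklore] -/
@[simp]
theorem gradDot_const_left (c : ℝ) (ψ : Config N → ℝ) (X : Config N) :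
    gradDot (fun _ : Config N => c) ψ X = 0 := by
  simp [gradDot]

/-- `Γ(φ₁ - φ₂, ψ) = Γ(φ₁, ψ) - Γ(φ₂, ψ)` at points of differentiability. [folklore] -/
theorem gradDot_sub_left (hφ₁ : DifferentiableAt ℝ φ₁ X) (hφ₂ : DifferentiableAt ℝ φ₂ X)
    (ψ : Config N → ℝ) : gradDot (φ₁ - φ₂) ψ X = gradDot φ₁ ψ X - gradDot φ₂ ψ X := by
  simp only [gradDot, pderiv_sub hφ₁ hφ₂, sub_mul, Finset.sum_sub_distrib]

/-- Polarisation: `|∇(φ - ψ)|² = |∇φ|² - 2 ∇φ·∇ψ + |∇ψ|²` at points of differentiability.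
[folklore] -/
theorem gradDot_sub_sub (hφ : DifferentiableAt ℝ φ X) (hψ : DifferentiableAt ℝ ψ X) :
    gradDot (φ - ψ) (φ - ψ) X = gradDot φ φ X - 2 * gradDot φ ψ X + gradDot ψ ψ X := by
  rw [gradDot_sub_left hφ hψ, gradDot_comm φ (φ - ψ), gradDot_comm ψ (φ - ψ),
    gradDot_sub_left hφ hψ, gradDot_sub_left hφ hψ, gradDot_comm ψ φ]
  ring

/-- `Γ(φ, ψ)` is continuous for `φ, ψ ∈ C¹`. [folklore] -/
theorem continuous_gradDot (hφ : ContDiff ℝ 1 φ) (hψ : ContDiff ℝ 1 ψ) :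
    Continuous (gradDot φ ψ) := by
  unfold gradDot
  exact continuous_finsetSum _ fun i _ => continuous_finsetSum _ fun k _ =>
    (continuous_pderiv hφ i k).mul (continuous_pderiv hψ i k)

end Gradient

/-! ### Periodic test functions -/

/-- **Periodic test functions** on the `N`-particle torus of side `L`: `φ : (ℝ³)^N → ℝ` of class
`C¹`, `Lℤ³`-periodic in every particle coordinate (stated on the generators `L e_{i,k}` of the
period lattice, as for `PeriodicTrialState`). This is the common core on which the weighted
Dirichlet form, the `H₋₁` supremum and the weak corrector equation are tested. [folklore] -/
def IsPeriodicTest (L : ℝ) (φ : Config N → ℝ) : Prop :=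
  ContDiff ℝ 1 φ ∧
    ∀ (X : Config N) (i : Fin N) (k : Fin 3), φ (X + Pi.single i (EuclideanSpace.single k L)) = φ X

namespace IsPeriodicTest

variable {L : ℝ} {φ ψ : Config N → ℝ}

/-- A periodic test function is `C¹`. [folklore] -/
theorem contDiff (h : IsPeriodicTest L φ) : ContDiff ℝ 1 φ := h.1

/-- A periodic test function is periodic under `X ↦ X + L e_{i,k}`. [folklore] -/
theorem periodic (h : IsPeriodicTest L φ) (X : Config N) (i : Fin N) (k : Fin 3) :
    φ (X + Pi.single i (EuclideanSpace.single k L)) = φ X := h.2 X i k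

/-- A periodic test function is continuous. [folklore] -/
theorem continuous (h : IsPeriodicTest L φ) : Continuous φ := h.1.continuous

/-- A periodic test function is differentiable. [folklore] -/
theorem differentiable (h : IsPeriodicTest L φ) : Differentiable ℝ φ :=
  h.1.differentiable one_ne_zero

/-- Constants are periodic test functions. [folklore] -/
theorem const (L c : ℝ) : IsPeriodicTest L (fun _ : Config N => c) :=
  ⟨contDiff_const, fun _ _ _ => rfl⟩

/-- `0` is a periodic test function. [folklore] -/
theorem zero (L : ℝ) : IsPeriodicTest L (0 : Config N → ℝ) :=
  ⟨contDiff_const, fun _ _ _ => rfl⟩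

/-- Sums of periodic test functions are periodic test functions. [folklore] -/
theorem add (hφ : IsPeriodicTest L φ) (hψ : IsPeriodicTest L ψ) : IsPeriodicTest L (φ + ψ) :=
  ⟨hφ.1.add hψ.1, fun X i k => by simp only [Pi.add_apply, hφ.2, hψ.2]⟩

/-- Negatives of periodic test functions are periodic test functions. [folklore] -/
theorem neg (hφ : IsPeriodicTest L φ) : IsPeriodicTest L (-φ) :=
  ⟨hφ.1.neg, fun X i k => by simp only [Pi.neg_apply, hφ.2]⟩

/-- Differences of periodic test functions are periodic test functions. [folklore] -/
theorem sub (hφ : IsPeriodicTest L φ) (hψ : IsPeriodicTest L ψ) : IsPeriodicTest L (φ - ψ) :=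
  ⟨hφ.1.sub hψ.1, fun X i k => by simp only [Pi.sub_apply, hφ.2, hψ.2]⟩

/-- Scalar multiples of periodic test functions are periodic test functions. [folklore] -/
theorem smul (c : ℝ) (hφ : IsPeriodicTest L φ) : IsPeriodicTest L (c • φ) :=
  ⟨contDiff_const.smul hφ.1, fun X i k => by simp only [Pi.smul_apply, hφ.2]⟩

/-- Products of periodic test functions are periodic test functions. [folklore] -/
theorem mul (hφ : IsPeriodicTest L φ) (hψ : IsPeriodicTest L ψ) : IsPeriodicTest L (φ * ψ) :=
  ⟨hφ.1.mul hψ.1, fun X i k => by simp only [Pi.mul_apply, hφ.2, hψ.2]⟩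

end IsPeriodicTest

/-! ### Integrability on the fundamental cell -/

section Cell

variable {L : ℝ}

/-- Points of the fundamental cell `[0,L)^{3N}` have (sup-Euclidean) norm at most `2|L|`.
[folklore] -/
theorem norm_le_two_mul_abs_of_mem_cellN {X : Config N} (hX : X ∈ cellN N L) : ‖X‖ ≤ 2 * |L| := by
  rw [pi_norm_le_iff_of_nonneg (by positivity)]
  intro i
  have hk : ∀ k, X i k ∈ Set.Ico 0 L := hX i
  have h2 : ‖X i‖ ^ 2 ≤ 3 * L ^ 2 := by
    rw [EuclideanSpace.norm_sq_eq]
    calc ∑ k, ‖X i k‖ ^ 2 ≤ ∑ _k : Fin 3, L ^ 2 :=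
          Finset.sum_le_sum fun k _ => by
            have h := hk k
            rw [Set.mem_Ico] at h
            rw [Real.norm_eq_abs, abs_of_nonneg h.1]
            exact pow_le_pow_left₀ h.1 h.2.le 2
      _ = 3 * L ^ 2 := by simp
  nlinarith [norm_nonneg (X i), abs_nonneg L, sq_abs L, le_abs_self L]

/-- The fundamental cell lies in the closed ball of radius `2|L|`. [folklore] -/
theorem cellN_subset_closedBall (N : ℕ) (L : ℝ) :
    cellN N L ⊆ closedBall (0 : Config N) (2 * |L|) := fun _ hX =>
  mem_closedBall_zero_iff.2 (norm_le_two_mul_abs_of_mem_cellN hX)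

/-- A continuous function on `(ℝ³)^N` is integrable on the (bounded) fundamental cell.
[folklore] -/
theorem integrableOn_cellN {E : Type*} [NormedAddCommGroup E] {f : Config N → E}
    (hf : Continuous f) (L : ℝ) : IntegrableOn f (cellN N L) volume :=
  (hf.continuousOn.integrableOn_compact (isCompact_closedBall (0 : Config N) (2 * |L|))).mono_set
    (cellN_subset_closedBall N L)

end Cell

/-! ### The weighted Dirichlet form -/

section DirichletForm

variable {L : ℝ} {F φ ψ : Config N → ℝ}

/-- The **weighted Dirichlet form** `𝓔_F(φ, ψ) = ∫_{[0,L)^{3N}} ∇φ·∇ψ F² dX` of the weight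
`F : (ℝ³)^N → ℝ` on the `N`-particle torus of side `L`: the form of the `F² dX`-symmetric
diffusion with generator `L_F = Δ + 2∇(log F)·∇` (`⟨φ, -L_F ψ⟩_{F²dX} = 𝓔_F(φ, ψ)` for periodic
`φ, ψ`), i.e. of the ground-state transform of `-Δ + (ΔF)/F`; it plays the role of
Kipnis–Landim's `H₁` inner product `⟨φ, (-S) ψ⟩_π` [KipnisLandim1999, App. 1 §6] for this
diffusion (unnormalised `π = F² dX`). Real Bochner integral on the fundamental cell. [folklore] -/
def dirichletFormW (L : ℝ) (F φ ψ : Config N → ℝ) : ℝ :=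
  ∫ X in cellN N L, gradDot φ ψ X * F X ^ 2

/-- Unfolding `𝓔_F`. [folklore] -/
theorem dirichletFormW_def (L : ℝ) (F φ ψ : Config N → ℝ) :
    dirichletFormW L F φ ψ = ∫ X in cellN N L, gradDot φ ψ X * F X ^ 2 := rfl

/-- `𝓔_F` is symmetric. [folklore] -/
theorem dirichletFormW_comm (L : ℝ) (F φ ψ : Config N → ℝ) :
    dirichletFormW L F φ ψ = dirichletFormW L F ψ φ := by
  unfold dirichletFormW
  congr 1 with X
  rw [gradDot_comm]

/-- `𝓔_F(c φ, ψ) = c 𝓔_F(φ, ψ)`. [folklore] -/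
theorem dirichletFormW_smul_left (c : ℝ) (L : ℝ) (F φ ψ : Config N → ℝ) :
    dirichletFormW L F (c • φ) ψ = c * dirichletFormW L F φ ψ := by
  simp only [dirichletFormW, gradDot_smul_left, mul_assoc]
  exact integral_const_mul c _

/-- `𝓔_F(φ, c ψ) = c 𝓔_F(φ, ψ)`. [folklore] -/
theorem dirichletFormW_smul_right (c : ℝ) (L : ℝ) (F φ ψ : Config N → ℝ) :
    dirichletFormW L F φ (c • ψ) = c * dirichletFormW L F φ ψ := by
  rw [dirichletFormW_comm, dirichletFormW_smul_left, dirichletFormW_comm]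

/-- `𝓔_F(φ, φ) = ∫ |∇φ|² F² ≥ 0`. [folklore] -/
theorem dirichletFormW_self_nonneg (L : ℝ) (F φ : Config N → ℝ) : 0 ≤ dirichletFormW L F φ φ :=
  integral_nonneg fun X => mul_nonneg (gradDot_self_nonneg φ X) (sq_nonneg _)

/-- `𝓔_F(φ, c) = 0` for a constant `c` (constants are `𝓔_F`-null). [folklore] -/
@[simp]
theorem dirichletFormW_const_right (L : ℝ) (F φ : Config N → ℝ) (c : ℝ) :
    dirichletFormW L F φ (fun _ => c) = 0 := by
  simp [dirichletFormW]

/-- `𝓔_F(c, ψ) = 0` for a constant `c`. [folklore] -/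
@[simp]
theorem dirichletFormW_const_left (L : ℝ) (F ψ : Config N → ℝ) (c : ℝ) :
    dirichletFormW L F (fun _ => c) ψ = 0 := by
  simp [dirichletFormW]

/-- The integrand `Γ(φ, ψ) F²` of `𝓔_F` is integrable on the cell for `C¹` test functions and a
continuous weight. [folklore] -/
theorem integrableOn_gradDot_mul_sq (hF : Continuous F) (hφ : ContDiff ℝ 1 φ) (hψ : ContDiff ℝ 1 ψ)
    (L : ℝ) : IntegrableOn (fun X => gradDot φ ψ X * F X ^ 2) (cellN N L) volume :=
  integrableOn_cellN ((continuous_gradDot hφ hψ).mul (hF.pow 2)) L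

/-- **Polarisation of the Dirichlet form**: `𝓔_F(φ - ψ, φ - ψ) = 𝓔_F(φ,φ) - 2𝓔_F(φ,ψ) + 𝓔_F(ψ,ψ)`
for periodic test functions and a continuous weight. [folklore] -/
theorem dirichletFormW_sub_sub (hF : Continuous F) (hφ : IsPeriodicTest L φ)
    (hψ : IsPeriodicTest L ψ) :
    dirichletFormW L F (φ - ψ) (φ - ψ) =
      dirichletFormW L F φ φ - 2 * dirichletFormW L F φ ψ + dirichletFormW L F ψ ψ := by
  unfold dirichletFormW
  have hpt : ∀ X, gradDot (φ - ψ) (φ - ψ) X * F X ^ 2 =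
      gradDot φ φ X * F X ^ 2 - 2 * (gradDot φ ψ X * F X ^ 2) + gradDot ψ ψ X * F X ^ 2 := by
    intro X
    rw [gradDot_sub_sub (hφ.differentiable X) (hψ.differentiable X)]
    ring
  simp_rw [hpt]
  have h1 := integrableOn_gradDot_mul_sq hF hφ.1 hφ.1 L
  have h2 := integrableOn_gradDot_mul_sq hF hφ.1 hψ.1 L
  have h3 := integrableOn_gradDot_mul_sq hF hψ.1 hψ.1 L
  have h12 : Integrable (fun X => gradDot φ φ X * F X ^ 2 - 2 * (gradDot φ ψ X * F X ^ 2))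
      (volume.restrict (cellN N L)) := h1.sub (h2.const_mul 2)
  rw [integral_add h12 h3, integral_sub h1 (h2.const_mul 2), integral_const_mul]

end DirichletForm

/-! ### The `H₋₁` norm -/

section HMinusOne

variable {L : ℝ} {F g φ : Config N → ℝ}

/-- The **`H₋₁` norm (squared)** `‖g‖²₋₁ = sup_φ {2 ∫_{[0,L)^{3N}} g φ F² dX - 𝓔_F(φ, φ)} ∈ [0, ∞]`
of a real observable `g` with respect to the weighted Dirichlet form `𝓔_F` and the measure
`F² dX` on the `N`-particle torus, the supremum running over periodic test functions `φ`
(Kipnis–Landim's variational formula (6.1), `‖f‖²₋₁ = sup_g {2⟨f, g⟩_π - ‖g‖₁²}`, on the `C¹`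
periodic core; Kipnis–Varadhan's `⟨V, (-L)⁻¹ V⟩ = ∫₀^∞ ⟨T_t V, V⟩ dt = σ²/2`). Each term is
truncated at `0` by `ENNReal.ofReal`, which does not change the supremum (`φ = 0` contributes
`0`). Finite iff `g` satisfies `(∫ g φ F²)² ≤ C 𝓔_F(φ, φ)` (`hMinusOneSqW_le_ofReal_iff`); `⊤`
unless `∫ g F² = 0` (`hMinusOneSqW_eq_top`). [cite: KipnisLandim1999, App. 1 §6 (6.1)] -/
def hMinusOneSqW (L : ℝ) (F g : Config N → ℝ) : ℝ≥0∞ :=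
  ⨆ (φ : Config N → ℝ) (_ : IsPeriodicTest L φ),
    ENNReal.ofReal (2 * (∫ X in cellN N L, g X * φ X * F X ^ 2) - dirichletFormW L F φ φ)

/-- The variational lower bound: every periodic test function `φ` gives
`2 ∫ g φ F² - 𝓔_F(φ, φ) ≤ ‖g‖²₋₁`. [cite: KipnisLandim1999, App. 1 §6 (6.1)] -/
theorem le_hMinusOneSqW (L : ℝ) (F g : Config N → ℝ) (hφ : IsPeriodicTest L φ) :
    ENNReal.ofReal (2 * (∫ X in cellN N L, g X * φ X * F X ^ 2) - dirichletFormW L F φ φ) ≤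
      hMinusOneSqW L F g := by
  unfold hMinusOneSqW
  exact le_iSup₂ (f := fun (φ : Config N → ℝ) (_ : IsPeriodicTest L φ) =>
    ENNReal.ofReal (2 * (∫ X in cellN N L, g X * φ X * F X ^ 2) - dirichletFormW L F φ φ)) φ hφ

/-- Scaling of the pairing in the test function: `∫ g (cφ) F² = c ∫ g φ F²`. [folklore] -/
theorem integral_mul_smul_mul_sq (c : ℝ) (L : ℝ) (F g φ : Config N → ℝ) :
    ∫ X in cellN N L, g X * (c • φ) X * F X ^ 2 = c * ∫ X in cellN N L, g X * φ X * F X ^ 2 := by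
  rw [← integral_const_mul]
  congr 1 with X
  simp only [Pi.smul_apply, smul_eq_mul]
  ring

/-- Joint scaling of the variational functional: replacing `(g, φ)` by `(c g, c φ)` multiplies
`2 ∫ g φ F² - 𝓔_F(φ, φ)` by `c²`. [folklore] -/
theorem hMinusOne_term_smul (c : ℝ) (L : ℝ) (F g φ : Config N → ℝ) :
    2 * (∫ X in cellN N L, (c • g) X * (c • φ) X * F X ^ 2) - dirichletFormW L F (c • φ) (c • φ) =
      c ^ 2 * (2 * (∫ X in cellN N L, g X * φ X * F X ^ 2) - dirichletFormW L F φ φ) := by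
  rw [dirichletFormW_smul_left, dirichletFormW_smul_right]
  have h : ∫ X in cellN N L, (c • g) X * (c • φ) X * F X ^ 2 =
      c ^ 2 * ∫ X in cellN N L, g X * φ X * F X ^ 2 := by
    rw [← integral_const_mul]
    congr 1 with X
    simp only [Pi.smul_apply, smul_eq_mul]
    ring
  rw [h]
  ring

/-- **Kipnis–Varadhan's criterion.** For `C ≥ 0`: `‖g‖²₋₁ ≤ C` iff
`(∫ g φ F² dX)² ≤ C · 𝓔_F(φ, φ)` for every periodic test function `φ` — condition (1.14) of
Kipnis–Varadhan, `|⟨V, φ⟩| ≤ C^{1/2} ⟨-Lφ, φ⟩^{1/2}`, with the optimal constant. (`⇒`: test against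
`t φ` and read off the discriminant; `⇐`: `2a - D ≤ C` whenever `a² ≤ C D`.)
[cite: KipnisVaradhan1986, (1.14)] -/
theorem hMinusOneSqW_le_ofReal_iff {C : ℝ} (hC : 0 ≤ C) :
    hMinusOneSqW L F g ≤ ENNReal.ofReal C ↔
      ∀ φ : Config N → ℝ, IsPeriodicTest L φ →
        (∫ X in cellN N L, g X * φ X * F X ^ 2) ^ 2 ≤ C * dirichletFormW L F φ φ := by
  constructor
  · intro h φ hφ
    set a : ℝ := ∫ X in cellN N L, g X * φ X * F X ^ 2
    set D : ℝ := dirichletFormW L F φ φ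
    have hq : ∀ t : ℝ, 0 ≤ D * (t * t) + -(2 * a) * t + C := by
      intro t
      have ht := (le_hMinusOneSqW L F g (hφ.smul t)).trans h
      rw [ENNReal.ofReal_le_ofReal_iff hC, integral_mul_smul_mul_sq, dirichletFormW_smul_left,
        dirichletFormW_smul_right] at ht
      nlinarith [ht]
    have hdisc := discrim_le_zero hq
    rw [discrim] at hdisc
    nlinarith [hdisc]
  · intro h
    unfold hMinusOneSqW
    refine iSup₂_le fun φ hφ => ?_
    rw [ENNReal.ofReal_le_ofReal_iff hC]
    have h1 := h φ hφ
    have hD := dirichletFormW_self_nonneg L F φ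
    by_contra hlt
    rw [not_le] at hlt
    have h2 : 0 < 2 * (∫ X in cellN N L, g X * φ X * F X ^ 2) - dirichletFormW L F φ φ - C := by
      linarith
    have h3 : 0 < 2 * (∫ X in cellN N L, g X * φ X * F X ^ 2) + dirichletFormW L F φ φ + C := by
      linarith
    nlinarith [mul_pos h2 h3, sq_nonneg (C - dirichletFormW L F φ φ)]

/-- `‖0‖₋₁ = 0`. [folklore] -/
@[simp]
theorem hMinusOneSqW_zero (L : ℝ) (F : Config N → ℝ) : hMinusOneSqW L F 0 = 0 := by
  refine le_antisymm ?_ zero_le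
  unfold hMinusOneSqW
  refine iSup₂_le fun φ _ => ?_
  have h : ENNReal.ofReal (2 * (∫ X in cellN N L, (0 : Config N → ℝ) X * φ X * F X ^ 2) -
      dirichletFormW L F φ φ) = 0 := by
    rw [ENNReal.ofReal_eq_zero]
    simp only [Pi.zero_apply, zero_mul, integral_zero, mul_zero, zero_sub, neg_nonpos]
    exact dirichletFormW_self_nonneg L F φ
  rw [h]

/-- **Quadratic scaling**: `‖c g‖²₋₁ = c² ‖g‖²₋₁` (reindex the supremum by `φ ↦ c φ`). [folklore] -/
theorem hMinusOneSqW_smul (c : ℝ) (L : ℝ) (F g : Config N → ℝ) :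
    hMinusOneSqW L F (c • g) = ENNReal.ofReal (c ^ 2) * hMinusOneSqW L F g := by
  rcases eq_or_ne c 0 with rfl | hc
  · simp
  refine le_antisymm ?_ ?_
  · unfold hMinusOneSqW
    refine iSup₂_le fun φ hφ => ?_
    -- write `φ = c • ψ` with `ψ = c⁻¹ • φ`
    have hφeq : c • (c⁻¹ • φ) = φ := by rw [smul_smul, mul_inv_cancel₀ hc, one_smul]
    have hψ : IsPeriodicTest L (c⁻¹ • φ) := hφ.smul c⁻¹
    calc ENNReal.ofReal (2 * (∫ X in cellN N L, (c • g) X * φ X * F X ^ 2) - dirichletFormW L F φ φ)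
        = ENNReal.ofReal (c ^ 2 * (2 * (∫ X in cellN N L, g X * (c⁻¹ • φ) X * F X ^ 2) -
            dirichletFormW L F (c⁻¹ • φ) (c⁻¹ • φ))) := by
          rw [← hMinusOne_term_smul c L F g (c⁻¹ • φ), hφeq]
      _ = ENNReal.ofReal (c ^ 2) * ENNReal.ofReal (2 * (∫ X in cellN N L, g X * (c⁻¹ • φ) X * F X ^ 2) -
            dirichletFormW L F (c⁻¹ • φ) (c⁻¹ • φ)) := ENNReal.ofReal_mul (sq_nonneg c)
      _ ≤ ENNReal.ofReal (c ^ 2) * ⨆ (ψ : Config N → ℝ) (_ : IsPeriodicTest L ψ),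
            ENNReal.ofReal (2 * (∫ X in cellN N L, g X * ψ X * F X ^ 2) - dirichletFormW L F ψ ψ) :=
          by gcongr; exact le_hMinusOneSqW L F g hψ
  · rw [hMinusOneSqW, ENNReal.mul_iSup]
    refine iSup_le fun ψ => ?_
    rw [ENNReal.mul_iSup]
    refine iSup_le fun hψ => ?_
    rw [← ENNReal.ofReal_mul (sq_nonneg c), ← hMinusOne_term_smul c L F g ψ]
    exact le_hMinusOneSqW L F (c • g) (hψ.smul c)

/-- **`‖g‖₋₁ = ∞` off the centred observables**: if `∫ g F² dX ≠ 0` then `‖g‖²₋₁ = ⊤` (test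
against the constants `φ ≡ t`, for which `𝓔_F(φ, φ) = 0`). Hence the `H₋₁` norm is only useful
for `g` centred with respect to `F² dX`, as in Kipnis–Varadhan's standing assumption `∫ V dπ = 0`
(their Thm. 1.8). [folklore] -/
theorem hMinusOneSqW_eq_top (h : (∫ X in cellN N L, g X * F X ^ 2) ≠ 0) :
    hMinusOneSqW L F g = ⊤ := by
  set m : ℝ := ∫ X in cellN N L, g X * F X ^ 2 with hm
  have hint : ∀ t : ℝ, ∫ X in cellN N L, g X * t * F X ^ 2 = t * m := fun t => by
    rw [hm, ← integral_const_mul]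
    exact integral_congr_ae (ae_of_all _ fun X => by ring)
  refine ENNReal.eq_top_of_forall_nnreal_le fun r => ?_
  -- the constant test function `t = r / (2m)` contributes `2 t m = r`
  have hconst := le_hMinusOneSqW L F g (IsPeriodicTest.const (N := N) L ((r : ℝ) / (2 * m)))
  rw [hint, dirichletFormW_const_right, sub_zero,
    show 2 * ((r : ℝ) / (2 * m) * m) = r by field_simp, ENNReal.ofReal_coe_nnreal] at hconst
  exact hconst

end HMinusOne

/-! ### Weak correctors -/

section Corrector

variable {L : ℝ} {F g δ : Config N → ℝ}

/-- **Weak corrector.** `δ` is a *weak corrector* of the observable `g` for the weight `F` on the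
`N`-particle torus of side `L` if `δ` is a periodic test function solving the weighted Poisson
(corrector) equation `-L_F δ = g`, `L_F = Δ + 2∇(log F)·∇`, in weak form on the torus:
`𝓔_F(δ, φ) = ∫ ∇δ·∇φ F² dX = ∫ g φ F² dX` for every periodic test function `φ`
(the Poisson equation behind Kipnis–Varadhan's `σ² = 2⟨-L⁻¹V, V⟩`, Cor. 1.9 of their paper;
Kipnis–Landim's resolvent equation `γ f_γ - L f_γ = g` (proof of Prop. 6.1) at `γ = 0`, i.e.
`g = (-S)δ ∈ S L²(π) ⊆ H₋₁`). Testing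
with constants forces `∫ g F² = 0` (`integral_mul_sq_eq_zero`); no existence statement is made
here. [cite: KipnisLandim1999, App. 1 §6 (proof of Prop. 6.1, γ = 0)] -/
def IsWeakCorrector (L : ℝ) (F g δ : Config N → ℝ) : Prop :=
  IsPeriodicTest L δ ∧
    ∀ φ : Config N → ℝ, IsPeriodicTest L φ →
      dirichletFormW L F δ φ = ∫ X in cellN N L, g X * φ X * F X ^ 2

namespace IsWeakCorrector

/-- A weak corrector is a periodic test function. [folklore] -/
theorem isPeriodicTest (h : IsWeakCorrector L F g δ) : IsPeriodicTest L δ := h.1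

/-- The weak corrector equation tested against `φ`. [folklore] -/
theorem dirichletFormW_eq (h : IsWeakCorrector L F g δ) {φ : Config N → ℝ}
    (hφ : IsPeriodicTest L φ) :
    dirichletFormW L F δ φ = ∫ X in cellN N L, g X * φ X * F X ^ 2 := h.2 φ hφ

/-- Energy identity `𝓔_F(δ, δ) = ∫ g δ F² dX` (test the equation against `δ` itself).
[folklore] -/
theorem dirichletFormW_self (h : IsWeakCorrector L F g δ) :
    dirichletFormW L F δ δ = ∫ X in cellN N L, g X * δ X * F X ^ 2 := h.2 δ h.1

/-- A weak corrector forces `g` to be centred: `∫ g F² dX = 0` (test against `φ ≡ 1`).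
[folklore] -/
theorem integral_mul_sq_eq_zero (h : IsWeakCorrector L F g δ) :
    ∫ X in cellN N L, g X * F X ^ 2 = 0 := by
  have h1 := h.2 (fun _ => 1) (IsPeriodicTest.const L 1)
  rw [dirichletFormW_const_right] at h1
  simpa using h1.symm

/-- **The corrector computes the `H₋₁` norm**: if `δ` is a weak corrector of `g` (continuous
weight), then `‖g‖²₋₁ = ∫ g δ F² dX = 𝓔_F(δ, δ)`: for every test `φ`,
`2∫ g φ F² - 𝓔_F(φ,φ) = 𝓔_F(δ,δ) - 𝓔_F(δ - φ, δ - φ) ≤ 𝓔_F(δ,δ)`, with equality at `φ = δ`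
(Kipnis–Landim: `‖S f‖²₋₁ = ‖f‖₁²`). [cite: KipnisLandim1999, App. 1 §6] -/
theorem hMinusOneSqW_eq (hF : Continuous F) (h : IsWeakCorrector L F g δ) :
    hMinusOneSqW L F g = ENNReal.ofReal (∫ X in cellN N L, g X * δ X * F X ^ 2) := by
  have hδ := h.1
  have key : ∀ φ : Config N → ℝ, IsPeriodicTest L φ →
      2 * (∫ X in cellN N L, g X * φ X * F X ^ 2) - dirichletFormW L F φ φ =
        dirichletFormW L F δ δ - dirichletFormW L F (δ - φ) (δ - φ) := by
    intro φ hφ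
    rw [← h.2 φ hφ, dirichletFormW_sub_sub hF hδ hφ]
    ring
  refine le_antisymm ?_ ?_
  · unfold hMinusOneSqW
    refine iSup₂_le fun φ hφ => ?_
    rw [key φ hφ, ← h.dirichletFormW_self]
    exact ENNReal.ofReal_le_ofReal (sub_le_self _ (dirichletFormW_self_nonneg L F _))
  · have hle := le_hMinusOneSqW L F g hδ
    rwa [← h.dirichletFormW_self, two_mul, add_sub_cancel_right, h.dirichletFormW_self] at hle

/-- With a corrector in hand, `‖g‖²₋₁` is finite (`S L²(π) ⊆ H₋₁`). [cite: KipnisLandim1999, App. 1 §6] -/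
theorem hMinusOneSqW_ne_top (hF : Continuous F) (h : IsWeakCorrector L F g δ) :
    hMinusOneSqW L F g ≠ ⊤ := by
  rw [h.hMinusOneSqW_eq hF]
  exact ENNReal.ofReal_ne_top

/-- The Kipnis–Varadhan bound delivered by a corrector: `(∫ g φ F²)² ≤ 𝓔_F(δ,δ) 𝓔_F(φ,φ)` for every
periodic test function `φ` (Cauchy–Schwarz for `𝓔_F`, via `hMinusOneSqW_le_ofReal_iff`).
[cite: KipnisVaradhan1986, (1.14)] -/
theorem sq_integral_le (hF : Continuous F) (h : IsWeakCorrector L F g δ) {φ : Config N → ℝ}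
    (hφ : IsPeriodicTest L φ) :
    (∫ X in cellN N L, g X * φ X * F X ^ 2) ^ 2 ≤
      dirichletFormW L F δ δ * dirichletFormW L F φ φ := by
  have hC : 0 ≤ dirichletFormW L F δ δ := dirichletFormW_self_nonneg L F δ
  have hle : hMinusOneSqW L F g ≤ ENNReal.ofReal (dirichletFormW L F δ δ) := by
    rw [h.hMinusOneSqW_eq hF, h.dirichletFormW_self]
  exact (hMinusOneSqW_le_ofReal_iff hC).1 hle φ hφ

end IsWeakCorrector

end Corrector

/-! ### Weight homogeneity, the constant-weight (free) case, and the `fderiv` form of the criterion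

API serving the second requesting route (`BECNewtonPolicyIteration`, definition item
`defn-WeightedCorrector-2`): its crux `TaggedCorrectorBound` spells the Kipnis–Varadhan bound out
with Mathlib's `fderiv` and explicit `C¹` + periodicity binders, and its scheme `TameNewtonScheme`
works with the *normalised* measures `μ_n = F_n² dX / ∫ F_n²`; all three objects are homogeneous of
degree two in the weight, and the corrector equation is invariant under `F ↦ c F`. -/

section WeightScaling

variable {L : ℝ} {F g φ ψ δ : Config N → ℝ}

/-- `|∇φ|²(X) = ∑ᵢ ∑ₖ (∂_{i,k} φ(X))²` with the partial derivatives written as Mathlib's `fderiv`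
applied to the unit vectors `e_{i,k}` (the integrand of `TaggedCorrectorBound`). [folklore] -/
theorem gradDot_self_eq_sum_sq (φ : Config N → ℝ) (X : Config N) :
    gradDot φ φ X =
      ∑ i : Fin N, ∑ k : Fin 3, (fderiv ℝ φ X (Pi.single i (EuclideanSpace.single k (1 : ℝ)))) ^ 2 := by
  simp only [gradDot, pderiv, sq]

/-- `𝓔_F(φ, φ) = ∫_{[0,L)^{3N}} (∑ᵢ ∑ₖ (∂_{i,k} φ)²) F² dX`, the diagonal of the weighted Dirichlet form
in the `fderiv` spelling of `TaggedCorrectorBound`. [folklore] -/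
theorem dirichletFormW_self_eq_integral_sum_sq (L : ℝ) (F φ : Config N → ℝ) :
    dirichletFormW L F φ φ = ∫ X in cellN N L,
      (∑ i : Fin N, ∑ k : Fin 3, (fderiv ℝ φ X (Pi.single i (EuclideanSpace.single k (1 : ℝ)))) ^ 2) *
        F X ^ 2 := by
  simp only [dirichletFormW, gradDot_self_eq_sum_sq]

/-- **Kipnis–Varadhan's criterion, `fderiv` form.** For `C ≥ 0`: `‖g‖²₋₁ ≤ C` iff for every `C¹`
function `φ` on `(ℝ³)^N` that is `Lℤ³`-periodic in every particle,
`(∫ g φ F² dX)² ≤ C ∫ (∑ᵢ ∑ₖ (∂_{i,k} φ)²) F² dX` — `hMinusOneSqW_le_ofReal_iff` with the test-function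
predicate and the Dirichlet form unfolded to the binders and the integrand used verbatim by the route
item `TaggedCorrectorBound` (there `g X = f (X 0) - ⟨f⟩`, `F = |Ψ|`, `C ↦ C / L³`).
[cite: KipnisVaradhan1986, (1.14)] -/
theorem hMinusOneSqW_le_ofReal_iff_fderiv {C : ℝ} (hC : 0 ≤ C) :
    hMinusOneSqW L F g ≤ ENNReal.ofReal C ↔
      ∀ φ : Config N → ℝ, ContDiff ℝ 1 φ →
        (∀ (X : Config N) (i : Fin N) (k : Fin 3),
            φ (X + Pi.single i (EuclideanSpace.single k L)) = φ X) →
          (∫ X in cellN N L, g X * φ X * F X ^ 2) ^ 2 ≤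
            C * ∫ X in cellN N L,
              (∑ i : Fin N, ∑ k : Fin 3,
                  (fderiv ℝ φ X (Pi.single i (EuclideanSpace.single k (1 : ℝ)))) ^ 2) * F X ^ 2 := by
  rw [hMinusOneSqW_le_ofReal_iff hC]
  constructor
  · intro h φ h₁ h₂
    rw [← dirichletFormW_self_eq_integral_sum_sq]
    exact h φ ⟨h₁, h₂⟩
  · intro h φ hφ
    rw [dirichletFormW_self_eq_integral_sum_sq]
    exact h φ hφ.1 hφ.2

/-- Scaling of the pairing in the weight: `∫ g φ (cF)² = c² ∫ g φ F²`. [folklore] -/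
theorem integral_mul_mul_smul_sq (c L : ℝ) (F g φ : Config N → ℝ) :
    ∫ X in cellN N L, g X * φ X * (c • F) X ^ 2 = c ^ 2 * ∫ X in cellN N L, g X * φ X * F X ^ 2 := by
  rw [← integral_const_mul]
  congr 1 with X
  simp only [Pi.smul_apply, smul_eq_mul]
  ring

/-- **Homogeneity of the Dirichlet form in the weight**: `𝓔_{cF}(φ, ψ) = c² 𝓔_F(φ, ψ)`. [folklore] -/
theorem dirichletFormW_smul_weight (c L : ℝ) (F φ ψ : Config N → ℝ) :
    dirichletFormW L (c • F) φ ψ = c ^ 2 * dirichletFormW L F φ ψ := by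
  simp only [dirichletFormW, ← integral_const_mul]
  congr 1 with X
  simp only [Pi.smul_apply, smul_eq_mul]
  ring

/-- **Homogeneity of the `H₋₁` norm in the weight**: `‖g‖²₋₁[cF] = c² ‖g‖²₋₁[F]` (every term of the
variational supremum scales by `c²`). In particular the norm for the normalised measure
`F² dX / ∫F²` is `(∫F²)⁻¹` times the unnormalised one (`hMinusOneSqW_normalised_weight`). [folklore] -/
theorem hMinusOneSqW_smul_weight (c L : ℝ) (F g : Config N → ℝ) :
    hMinusOneSqW L (c • F) g = ENNReal.ofReal (c ^ 2) * hMinusOneSqW L F g := by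
  simp only [hMinusOneSqW, ENNReal.mul_iSup]
  refine iSup_congr fun φ => iSup_congr fun _ => ?_
  rw [integral_mul_mul_smul_sq, dirichletFormW_smul_weight, ← ENNReal.ofReal_mul (sq_nonneg c)]
  congr 1
  ring

/-- The `H₋₁` norm for the **normalised weight** `F / (∫F²)^{1/2}` (reversible probability measure
`μ_F = F² dX / ∫_{[0,L)^{3N}} F²`, as in the policy-iteration scheme) is `(∫F²)⁻¹ ‖g‖²₋₁[F]`.
[folklore] -/
theorem hMinusOneSqW_normalised_weight (L : ℝ) (F g : Config N → ℝ) :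
    hMinusOneSqW L ((Real.sqrt (∫ X in cellN N L, F X ^ 2))⁻¹ • F) g =
      ENNReal.ofReal (∫ X in cellN N L, F X ^ 2)⁻¹ * hMinusOneSqW L F g := by
  rw [hMinusOneSqW_smul_weight, inv_pow, Real.sq_sqrt (integral_nonneg fun X => sq_nonneg (F X))]

/-- **The corrector equation is invariant under rescaling the weight** by a constant `c ≠ 0` (both
sides of `𝓔_{cF}(δ, φ) = ∫ g φ (cF)²` carry the factor `c²`): correctors for `F` and for the
normalised weight coincide. [folklore] -/
theorem isWeakCorrector_smul_weight_iff {c : ℝ} (hc : c ≠ 0) :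
    IsWeakCorrector L (c • F) g δ ↔ IsWeakCorrector L F g δ := by
  simp only [IsWeakCorrector, dirichletFormW_smul_weight, integral_mul_mul_smul_sq]
  exact and_congr_right fun _ => forall₂_congr fun _ _ =>
    (mul_right_injective₀ (pow_ne_zero 2 hc)).eq_iff

/-- **Constant weight (the free case).** For `F ≡ c` the weighted Dirichlet form is `c²` times the
flat Dirichlet integral `∫_{[0,L)^{3N}} ∇φ·∇ψ dX` of the torus. [folklore] -/
theorem dirichletFormW_const_weight (c L : ℝ) (φ ψ : Config N → ℝ) :
    dirichletFormW L (fun _ : Config N => c) φ ψ = c ^ 2 * ∫ X in cellN N L, gradDot φ ψ X := by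
  simp only [dirichletFormW, ← integral_const_mul]
  congr 1 with X
  ring

/-- For `F ≡ c` the `H₋₁` norm is `c²` times the flat one (`F ≡ 1`: the `Ḣ⁻¹` norm, squared, of
`g` on the `3N`-torus of side `L`, tested on the `C¹` periodic core). [folklore] -/
theorem hMinusOneSqW_const_weight (c L : ℝ) (g : Config N → ℝ) :
    hMinusOneSqW L (fun _ : Config N => c) g =
      ENNReal.ofReal (c ^ 2) * hMinusOneSqW L (fun _ : Config N => (1 : ℝ)) g := by
  have h := hMinusOneSqW_smul_weight c L (fun _ : Config N => (1 : ℝ)) g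
  simp only [Pi.smul_def, smul_eq_mul, mul_one] at h
  exact h

/-- For `F ≡ c ≠ 0` the weak corrector equation is the flat weak Poisson equation on the torus,
`∫ ∇δ·∇φ dX = ∫ g φ dX` for every periodic test `φ` (`-Δδ = g` weakly). [folklore] -/
theorem isWeakCorrector_const_weight_iff {c : ℝ} (hc : c ≠ 0) :
    IsWeakCorrector L (fun _ : Config N => c) g δ ↔
      IsPeriodicTest L δ ∧ ∀ φ : Config N → ℝ, IsPeriodicTest L φ →
        ∫ X in cellN N L, gradDot δ φ X = ∫ X in cellN N L, g X * φ X := by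
  have h := isWeakCorrector_smul_weight_iff (L := L) (F := fun _ : Config N => (1 : ℝ)) (g := g)
    (δ := δ) hc
  simp only [Pi.smul_def, smul_eq_mul, mul_one] at h
  rw [h]
  simp [IsWeakCorrector, dirichletFormW]

end WeightScaling

end Literature.MathematicalPhysics.QuantumManyBody.BoseGas
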